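import Literature.Probability.RandomPlanarGeometry.LatticeSlitIncrements
import Literature.Probability.RandomPlanarGeometry.HullHeightBound
import Mathlib.Topology.MetricSpace.Sequences
import HarnessLib

/-!
# The hull of a lattice past whose polyline may touch `∂D`: bounded hull, positive capacity and
# height bounds for every walk avoiding the target point `b`

Topic `Literature/Probability/RandomPlanarGeometry`; a companion of `LatticeSlitIncrements.lean` and
`LatticeSlitCapacityHeight.lean`. There the hull `K_η = Fill_ℍ(S_η)`, `S_η = closure (stem ∪ trace)`,
of a lattice path `η` of the discrete domain `Ω_δ` of a Dobrushin domain `(D; a, b)`, pulled back by a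
conformal map `φ : ℍ → D`, is shown to be a bounded hull (`LatticeSlit.isBoundedHull_pastHull`) under
the hypothesis that the polyline of `η` stays INSIDE `D`. The edges of `Ω_δ` are the closed lattice
segments contained in `closure D`, so the polyline of a walk may TOUCH `∂D` (at points interior to an
edge); the trace `φ⁻¹(polyline ∩ D)` then falls into several pieces, each accumulating on `ℝ`, and the
fill swallows the pockets they cut off. This file removes the hypothesis, assuming only that

* the starting mesh point `δ a` lies in `D` (so that the stem is a genuine arc of `ℍ` from `0`), and
* the polyline avoids the target point `b = D.pt 1 = φ(∞)` (`φ` has boundary value `b` at `∞`,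
  `ConformalEquiv.HasBoundaryValueAtInfty`); a polyline THROUGH `b` has an unbounded pull-back and
  no hydrodynamic map (junk capacity `0`), so this hypothesis cannot be dropped.

Results (namespace `LatticeSlit`):

* `isBounded_trace_of_notMem` — the pulled-back trace is bounded: a sequence of trace points tending
  to `∞` in `ℍ` is mapped by `φ` to polyline points tending to `b` (boundary value at `∞`), and the
  polyline is compact;
* `isConnected_pastSet_union_of_notMem` — `S_η ∪ {im ≤ 0}` is connected (no boundary correspondence
  is needed: if an open partition separated a trace point from the stem side, follow the polyline
  parameter back to its last exit from `D`; the pulled-back points accumulate at a point which cannot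
  lie in `ℍ` — `φ` of it would be a point of `D` equal to a point off `D` — hence lies in `{im ≤ 0}`,
  on the stem side);
* `isBoundedHull_pastHull_of_notMem`, `hasHydroMap_pastHull_of_notMem` — `K_η ∈ 𝒬` and `g_{K_η}`
  exists ([LSW] §2 "Fillings"; Lawler (2005), Prop. 3.36);
* `capTime_pos_of_notMem` (`t_η > 0`, Lawler (2005), (3.8)), `im_sq_le_four_mul_capTime_of_notMem`,
  `im_symm_sq_le_four_mul_capTime_of_notMem` (`(im)² ≤ 2 hcap = 4 t_η` on `S_η` and at the pulled-back
  vertices, Kemppainen–Smirnov (2017), Lemma A.13), and `exists_radius_forall_le_dist_of_notMem`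
  (pasts with `t_η ≤ (Im w)²/16` keep their vertices `ρ(φ, w)`-far from `φ(w)`).

## References

* G. F. Lawler, O. Schramm, W. Werner, *Conformal restriction: the chordal case*, JAMS 16 (2003), §2
  p. 8 (Fillings) [LawlerSchrammWerner2003Restriction].
* G. F. Lawler, *Conformally Invariant Processes in the Plane*, AMS (2005), §3.4 Prop. 3.36, (3.8),
  §4.1 Thm. 4.6 [Lawler2005].
* A. Kemppainen, S. Smirnov, Ann. Probab. 45 (2017), App. A, Lemma A.13 [KemppainenSmirnov2017].
-/

noncomputable section

open Set Filter Topology Metric Bornology Complex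
open UpperHalfPlane (upperHalfPlaneSet isOpen_upperHalfPlaneSet)
open Literature.Probability.LatticeModels (meshPoint discreteDomainGraph Site discreteDomainGraph_adj_iff
  meshDomain_subset_meshVertices mem_meshVertices_iff)

namespace Literature.Probability.RandomPlanarGeometry

namespace LatticeSlit

variable {D : DobrushinDomain} {φ : ConformalEquiv upperHalfPlaneSet D.carrier} {δ : ℝ}
  {a w : Site 2}

/-! ### Vertices of a walk of `Ω_δ` have their mesh points in `D` -/

/-- The end-point of an edge of `Ω_δ` has its mesh point in `Ω`. [folklore] -/
theorem meshPoint_mem_of_adj {Ω : Set ℂ} {x y : Site 2} (h : (discreteDomainGraph Ω δ).Adj x y) :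
    meshPoint δ y ∈ Ω :=
  mem_meshVertices_iff.1 (meshDomain_subset_meshVertices Ω δ (discreteDomainGraph_adj_iff.1 h).2.2)

/-- Every vertex of a walk of `Ω_δ` started at a site whose mesh point lies in `Ω` has its mesh point
in `Ω`. [folklore] -/
theorem meshPoint_mem_of_mem_support {Ω : Set ℂ} {x y : Site 2} (η : (discreteDomainGraph Ω δ).Walk x y)
    (h0 : meshPoint δ x ∈ Ω) {v : Site 2} (hv : v ∈ η.support) : meshPoint δ v ∈ Ω := by
  induction η with
  | nil => 
    rw [SimpleGraph.Walk.support_nil, List.mem_singleton] at hv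
    exact hv ▸ h0
  | cons h p ih =>
    rw [SimpleGraph.Walk.support_cons, List.mem_cons] at hv
    rcases hv with rfl | hv
    · exact h0
    · exact ih (meshPoint_mem_of_adj h) hv

/-! ### The trace of a walk avoiding `b` is bounded -/

/-- **The pulled-back trace of a walk whose polyline avoids `b = φ(∞)` is bounded**: trace points
tending to `∞` in `ℍ` are mapped by `φ` to polyline points tending to `b` (boundary value of `φ` at
`∞`), and the polyline is compact, so it would contain `b`. [cite: Lawler2005, §4.1 (p. 94)] -/
theorem isBounded_trace_of_notMem (η : (discreteDomainGraph D.carrier δ).Walk a w)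
    (hb : φ.HasBoundaryValueAtInfty (D.pt 1)) (hnb : D.pt 1 ∉ range (η.toCurve (meshPoint δ))) :
    IsBounded (trace φ η) := by
  by_contra h
  have h' : ∀ n : ℕ, ∃ x ∈ trace φ η, (n : ℝ) < ‖x‖ := by
    intro n
    by_contra hn
    apply h
    refine (isBounded_iff_subset_closedBall 0).2 ⟨n, fun x hx ↦ ?_⟩
    rw [mem_closedBall, dist_zero_right]
    exact le_of_not_gt fun hlt ↦ hn ⟨x, hx, hlt⟩
  choose x hx hxn using h'
  have hp : ∀ n, ∃ p ∈ range (η.toCurve (meshPoint δ)) ∩ D.carrier, φ.symm p = x n := fun n ↦ hx n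
  choose p hp hpx using hp
  have hxH : ∀ n, x n ∈ upperHalfPlaneSet := fun n ↦ hpx n ▸ φ.symm_mapsTo (hp n).2
  have hφx : ∀ n, φ (x n) = p n := fun n ↦ by rw [← hpx n, φ.apply_symm_apply (hp n).2]
  -- `x n → ∞` within `ℍ`
  have hnorm : Tendsto (fun n ↦ ‖x n‖) atTop atTop :=
    tendsto_atTop_mono (fun n ↦ (hxn n).le) tendsto_natCast_atTop_atTop
  have hco : Tendsto x atTop (cocompact ℂ) := by
    rw [← cobounded_eq_cocompact]
    exact tendsto_norm_atTop_iff_cobounded.1 hnorm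
  have hT : Tendsto x atTop (cocompact ℂ ⊓ 𝓟 upperHalfPlaneSet) :=
    tendsto_inf.2 ⟨hco, tendsto_principal.2 (Eventually.of_forall hxH)⟩
  have hlim : Tendsto (fun n ↦ φ (x n)) atTop (𝓝 (D.pt 1)) := hb.comp hT
  have hlim' : Tendsto p atTop (𝓝 (D.pt 1)) := hlim.congr hφx
  have hclosed : IsClosed (range (η.toCurve (meshPoint δ))) :=
    (isCompact_range (map_continuous _)).isClosed
  exact hnb (hclosed.mem_of_tendsto hlim' (Eventually.of_forall fun n ↦ (hp n).1))

/-! ### The generating set of a walk avoiding `b` is attached to `ℝ` -/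

/-- Real-parameter form of the polyline of a walk (`IccExtend` of the curve on `[0, 1]`). [folklore] -/
def curveExt (η : (discreteDomainGraph D.carrier δ).Walk a w) : ℝ → ℂ :=
  IccExtend zero_le_one (η.toCurve (meshPoint δ))

/-- The real-parameter polyline is continuous. [folklore] -/
theorem continuous_curveExt (η : (discreteDomainGraph D.carrier δ).Walk a w) :
    Continuous (curveExt η) :=
  (map_continuous (η.toCurve (meshPoint δ))).Icc_extend'

/-- The real-parameter polyline takes values in the polyline. [folklore] -/
theorem curveExt_mem_range (η : (discreteDomainGraph D.carrier δ).Walk a w) (s : ℝ) :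
    curveExt η s ∈ range (η.toCurve (meshPoint δ)) := by
  rw [curveExt, IccExtend_apply]
  exact mem_range_self _

/-- The real-parameter polyline starts at `δ a`. [folklore] -/
theorem curveExt_zero (η : (discreteDomainGraph D.carrier δ).Walk a w) : curveExt η 0 = meshPoint δ a := by
  rw [curveExt, IccExtend_of_mem _ _ (left_mem_Icc.2 zero_le_one)]
  exact SimpleGraph.Walk.toCurve_apply_zero _ _

/-- Every trace point is `φ⁻¹(c(t₀))` for a parameter `t₀ ∈ [0, 1]` with `c(t₀) ∈ D`. [folklore] -/
theorem exists_param_of_mem_trace (η : (discreteDomainGraph D.carrier δ).Walk a w) {y : ℂ}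
    (hy : y ∈ trace φ η) : ∃ t₀ ∈ Icc (0 : ℝ) 1, curveExt η t₀ ∈ D.carrier ∧ φ.symm (curveExt η t₀) = y := by
  obtain ⟨p, ⟨⟨t, rfl⟩, hpD⟩, hpy⟩ := hy
  refine ⟨t, t.2, ?_, ?_⟩ <;> rw [curveExt, IccExtend_of_mem _ _ t.2]
  · exact hpD
  · exact hpy

/-- A connected piece of trace: the pull-back of a parameter interval mapped into `D`. [folklore] -/
theorem isPreconnected_image_symm_curveExt (η : (discreteDomainGraph D.carrier δ).Walk a w)
    {J : Set ℝ} (hJ : IsPreconnected J) (hJD : ∀ s ∈ J, curveExt η s ∈ D.carrier) :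
    IsPreconnected ((fun s ↦ φ.symm (curveExt η s)) '' J) := by
  refine hJ.image _ ?_
  exact φ.symm.continuousOn.comp (continuous_curveExt η).continuousOn hJD

/-- Such a piece lies in the trace. [folklore] -/
theorem image_symm_curveExt_subset_trace (η : (discreteDomainGraph D.carrier δ).Walk a w)
    {J : Set ℝ} (hJD : ∀ s ∈ J, curveExt η s ∈ D.carrier) :
    (fun s ↦ φ.symm (curveExt η s)) '' J ⊆ trace φ η := by
  rintro _ ⟨s, hs, rfl⟩
  exact ⟨curveExt η s, ⟨curveExt_mem_range η s, hJD s hs⟩, rfl⟩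

/-- **Key step.** If two open sets `u, v` cover `M ∪ closure (trace)` (`M = closure (stem) ∪ {im ≤ 0}`)
without common points there, and the stem side `M` lies in `u`, then so does `closure (trace)`:
otherwise some trace point `φ⁻¹(c(t₀))` lies in `v`; going back along the polyline to the last
parameter `s₀ < t₀` with `c(s₀) ∉ D` (or to `0` if there is none, where the base point sits on the
stem, in `u`), the connected piece `φ⁻¹(c(s₀, t₀])` lies in `v`, and its accumulation points as
`s ↓ s₀` have `im ≤ 0` (a limit in `ℍ` would be mapped by `φ` to `c(s₀) ∉ D`), hence lie in
`M ⊆ u` — but `u` is open. [folklore] -/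
theorem closure_trace_subset_of_cover (η : (discreteDomainGraph D.carrier δ).Walk a w)
    (hb : φ.HasBoundaryValueAtInfty (D.pt 1))
    (hnb : D.pt 1 ∉ range (η.toCurve (meshPoint δ))) {u v : Set ℂ} (hu : IsOpen u) (hv : IsOpen v)
    (hsub : closure (stemArc (basePt φ δ a)) ∪ {z : ℂ | z.im ≤ 0} ∪ closure (trace φ η) ⊆ u ∪ v)
    (hdisj : (closure (stemArc (basePt φ δ a)) ∪ {z : ℂ | z.im ≤ 0} ∪ closure (trace φ η)) ∩ (u ∩ v) = ∅)
    (hMu : closure (stemArc (basePt φ δ a)) ∪ {z : ℂ | z.im ≤ 0} ⊆ u) :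
    closure (trace φ η) ⊆ u := by
  set Z := closure (stemArc (basePt φ δ a)) ∪ {z : ℂ | z.im ≤ 0} ∪ closure (trace φ η) with hZ
  have hZdisj : ∀ z ∈ Z, z ∈ u → z ∈ v → False := fun z hz hzu hzv ↦ by
    have : z ∈ Z ∩ (u ∩ v) := ⟨hz, hzu, hzv⟩
    rw [hdisj] at this
    exact this
  have htrZ : trace φ η ⊆ Z := subset_closure.trans subset_union_right
  intro x hx
  by_contra hxu
  have hxv : x ∈ v := ((hsub (Or.inr hx)).resolve_left hxu)
  -- a trace point in `v`
  obtain ⟨y, hyv, hytr⟩ := mem_closure_iff.1 hx v hv hxv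
  obtain ⟨t₀, ht₀, ht₀D, rfl⟩ := exists_param_of_mem_trace η hytr
  -- pieces of trace meeting `v` lie in `v`
  have piece : ∀ J : Set ℝ, IsPreconnected J → (∀ s ∈ J, curveExt η s ∈ D.carrier) → t₀ ∈ J →
      (fun s ↦ φ.symm (curveExt η s)) '' J ⊆ v := by
    intro J hJ hJD ht₀J
    have hP := isPreconnected_image_symm_curveExt (φ := φ) η hJ hJD
    have hPZ : (fun s ↦ φ.symm (curveExt η s)) '' J ⊆ Z :=
      (image_symm_curveExt_subset_trace η hJD).trans htrZ
    rcases isPreconnected_iff_subset_of_disjoint.1 hP u v hu hv (hPZ.trans hsub)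
      (subset_eq_empty (inter_subset_inter_left _ hPZ) hdisj) with hPu | hPv
    · exact (hZdisj _ (hPZ ⟨t₀, ht₀J, rfl⟩) (hPu ⟨t₀, ht₀J, rfl⟩) hyv).elim
    · exact hPv
  -- the bad parameters before `t₀`
  set B : Set ℝ := {s | s ∈ Icc (0 : ℝ) t₀ ∧ curveExt η s ∉ D.carrier} with hB
  rcases B.eq_empty_or_nonempty with hBe | hBne
  · -- no bad parameter: the piece `φ⁻¹(c[0, t₀])` joins the base point (in `u`) to `y` (in `v`)
    have hJD : ∀ s ∈ Icc (0 : ℝ) t₀, curveExt η s ∈ D.carrier := fun s hs ↦ by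
      by_contra hsD
      have : s ∈ B := ⟨hs, hsD⟩
      rw [hBe] at this
      exact this
    have hsubv := piece (Icc 0 t₀) isPreconnected_Icc hJD (right_mem_Icc.2 ht₀.1)
    have h0mem : φ.symm (curveExt η 0) ∈ v := hsubv ⟨0, left_mem_Icc.2 ht₀.1, rfl⟩
    rw [curveExt_zero] at h0mem
    have hstem : φ.symm (meshPoint δ a) ∈ closure (stemArc (basePt φ δ a)) :=
      subset_closure (self_mem_stemArc _)
    exact hZdisj _ (Or.inl (Or.inl hstem)) (hMu (Or.inl hstem)) h0mem
  -- the last bad parameter `s₀ < t₀`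
  have hBclosed : IsClosed B := by
    have : B = Icc (0 : ℝ) t₀ ∩ (curveExt η) ⁻¹' (D.carrier)ᶜ := by
      ext s; simp [hB]
    rw [this]
    exact isClosed_Icc.inter (D.isOpen.isClosed_compl.preimage (continuous_curveExt η))
  have hBbdd : BddAbove B := ⟨t₀, fun s hs ↦ hs.1.2⟩
  set s₀ := sSup B with hs₀
  have hs₀B : s₀ ∈ B := hBclosed.csSup_mem hBne hBbdd
  have hs₀t : s₀ ≤ t₀ := hs₀B.1.2
  have hs₀D : curveExt η s₀ ∉ D.carrier := hs₀B.2
  have hs₀lt : s₀ < t₀ := lt_of_le_of_ne hs₀t fun h ↦ hs₀D (h ▸ ht₀D)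
  have hgood : ∀ s ∈ Ioc s₀ t₀, curveExt η s ∈ D.carrier := fun s hs ↦ by
    by_contra hsD
    have hsB : s ∈ B := ⟨⟨hs₀B.1.1.trans hs.1.le, hs.2⟩, hsD⟩
    exact (not_le.2 hs.1) (le_csSup hBbdd hsB)
  have hsubv := piece (Ioc s₀ t₀) isPreconnected_Ioc hgood ⟨hs₀lt, le_rfl⟩
  -- approach `s₀` from the right
  set sk : ℕ → ℝ := fun k ↦ s₀ + (t₀ - s₀) / ((k : ℝ) + 2) with hsk
  have hskmem : ∀ k, sk k ∈ Ioc s₀ t₀ := fun k ↦ by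
    have hk : (2 : ℝ) ≤ (k : ℝ) + 2 := by linarith [(Nat.cast_nonneg k : (0 : ℝ) ≤ k)]
    have hpos : 0 < t₀ - s₀ := sub_pos.2 hs₀lt
    have hq : 0 < (t₀ - s₀) / ((k : ℝ) + 2) := div_pos hpos (by linarith)
    have hq' : (t₀ - s₀) / ((k : ℝ) + 2) ≤ t₀ - s₀ := div_le_self hpos.le (by linarith)
    constructor
    · show s₀ < s₀ + (t₀ - s₀) / ((k : ℝ) + 2)
      linarith
    · show s₀ + (t₀ - s₀) / ((k : ℝ) + 2) ≤ t₀
      linarith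
  have hsk_lim : Tendsto sk atTop (𝓝 s₀) := by
    have h1 : Tendsto (fun k : ℕ ↦ (t₀ - s₀) / ((k : ℝ) + 2)) atTop (𝓝 0) :=
      tendsto_const_nhds.div_atTop (tendsto_atTop_add_const_right _ _ tendsto_natCast_atTop_atTop)
    simpa [hsk] using tendsto_const_nhds.add h1
  set zk : ℕ → ℂ := fun k ↦ φ.symm (curveExt η (sk k)) with hzk
  have hzkv : ∀ k, zk k ∈ v := fun k ↦ hsubv ⟨sk k, hskmem k, rfl⟩
  have hzktr : ∀ k, zk k ∈ trace φ η := fun k ↦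
    image_symm_curveExt_subset_trace η hgood ⟨sk k, hskmem k, rfl⟩
  -- a convergent subsequence (the trace is bounded)
  obtain ⟨zs, -, ψ, hψ, hconv⟩ :=
    tendsto_subseq_of_bounded (isBounded_trace_of_notMem η hb hnb) hzktr
  -- its limit is not in `ℍ`
  have hzs : zs.im ≤ 0 := by
    by_contra hpos
    have hzsH : zs ∈ upperHalfPlaneSet := lt_of_not_ge hpos
    have hφc : ContinuousAt φ zs :=
      (φ.continuousOn zs hzsH).continuousAt (isOpen_upperHalfPlaneSet.mem_nhds hzsH)
    have hA : Tendsto (fun j ↦ φ (zk (ψ j))) atTop (𝓝 (φ zs)) := hφc.tendsto.comp hconv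
    have hB' : Tendsto (fun j ↦ φ (zk (ψ j))) atTop (𝓝 (curveExt η s₀)) := by
      have hc : Tendsto (fun j ↦ curveExt η (sk (ψ j))) atTop (𝓝 (curveExt η s₀)) :=
        ((continuous_curveExt η).tendsto s₀).comp (hsk_lim.comp hψ.tendsto_atTop)
      refine hc.congr fun j ↦ ?_
      simp only [hzk]
      rw [φ.apply_symm_apply (hgood _ (hskmem _))]
    have heq : φ zs = curveExt η s₀ := tendsto_nhds_unique hA hB'
    exact hs₀D (heq ▸ φ.mapsTo hzsH)
  -- hence on the stem side, in the open set `u`: the subsequence enters `u` while staying in `v`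
  have hzsu : zs ∈ u := hMu (Or.inr hzs)
  have hev : ∀ᶠ j in atTop, zk (ψ j) ∈ u := hconv (hu.mem_nhds hzsu)
  obtain ⟨j, hj⟩ := hev.exists
  exact hZdisj _ (htrZ (hzktr _)) hj (hzkv _)

/-- **`S_η ∪ {im ≤ 0}` is connected** for a walk started inside `D` whose polyline avoids `b`.
[folklore] -/
theorem isConnected_pastSet_union_of_notMem (η : (discreteDomainGraph D.carrier δ).Walk a w)
    (h0 : meshPoint δ a ∈ D.carrier) (hb : φ.HasBoundaryValueAtInfty (D.pt 1))
    (hnb : D.pt 1 ∉ range (η.toCurve (meshPoint δ))) :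
    IsConnected (pastSet φ η ∪ {z : ℂ | z.im ≤ 0}) := by
  have hz₀ : 0 < (basePt φ δ a).im := φ.symm_mapsTo h0
  set M := closure (stemArc (basePt φ δ a)) ∪ {z : ℂ | z.im ≤ 0} with hM
  have hMconn : IsConnected M := by
    have h1 : IsConnected (closure (stemArc (basePt φ δ a))) := (isConnected_stemArc hz₀.le).closure
    have h2 : IsConnected {z : ℂ | z.im ≤ 0} := (convex_halfSpace_im_le 0).isConnected ⟨0, by simp⟩
    exact h1.union ⟨0, zero_mem_closure_stemArc hz₀, by simp⟩ h2
  have hZ_eq : pastSet φ η ∪ {z : ℂ | z.im ≤ 0} = M ∪ closure (trace φ η) := by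
    rw [pastSet, closure_union, hM, union_right_comm]
  rw [hZ_eq]
  refine ⟨⟨0, Or.inl (Or.inr (by simp))⟩, ?_⟩
  rw [isPreconnected_iff_subset_of_disjoint]
  intro u v hu hv hsub hdisj
  have hMsub : M ⊆ u ∪ v := subset_union_left.trans hsub
  have hMdisj : M ∩ (u ∩ v) = ∅ := subset_eq_empty (inter_subset_inter_left _ subset_union_left) hdisj
  rcases isPreconnected_iff_subset_of_disjoint.1 hMconn.isPreconnected u v hu hv hMsub hMdisj with
    hMu | hMv
  · exact Or.inl (union_subset hMu (closure_trace_subset_of_cover η hb hnb hu hv hsub hdisj hMu))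
  · refine Or.inr (union_subset hMv (closure_trace_subset_of_cover η hb hnb hv hu
      (fun x hx ↦ (hsub hx).symm) ?_ hMv))
    rwa [inter_comm v u]

/-- **The generating set of a walk started inside `D` and avoiding `b` is closed, bounded and
attached to `ℝ`.** [folklore] -/
theorem pastSet_attached_of_notMem (η : (discreteDomainGraph D.carrier δ).Walk a w)
    (h0 : meshPoint δ a ∈ D.carrier) (hb : φ.HasBoundaryValueAtInfty (D.pt 1))
    (hnb : D.pt 1 ∉ range (η.toCurve (meshPoint δ))) :
    IsClosed (pastSet φ η) ∧ IsBounded (pastSet φ η) ∧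
      IsConnected (pastSet φ η ∪ {z : ℂ | z.im ≤ 0}) := by
  have hz₀ : 0 < (basePt φ δ a).im := φ.symm_mapsTo h0
  exact ⟨isClosed_closure,
    ((isBounded_stemArc hz₀.le).union (isBounded_trace_of_notMem η hb hnb)).closure,
    isConnected_pastSet_union_of_notMem η h0 hb hnb⟩

/-! ### Consequences: bounded hull, hydrodynamic map, positive capacity, height bounds -/

/-- **The hull of a walk started inside `D` and avoiding `b` is a bounded hull** (`K_η ∈ 𝒬`).
[cite: LawlerSchrammWerner2003Restriction, §2 p. 8 (Fillings)] -/
theorem isBoundedHull_pastHull_of_notMem (η : (discreteDomainGraph D.carrier δ).Walk a w)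
    (h0 : meshPoint δ a ∈ D.carrier) (hb : φ.HasBoundaryValueAtInfty (D.pt 1))
    (hnb : D.pt 1 ∉ range (η.toCurve (meshPoint δ))) : IsBoundedHull (pastHull φ η) := by
  obtain ⟨h1, h2, h3⟩ := pastSet_attached_of_notMem (φ := φ) η h0 hb hnb
  exact isBoundedHull_hpFill isSimplyConnected_of_isConnected_compl_holds h1 h2 h3

/-- So it has its hydrodynamic map `g_{K_η}`. [cite: Lawler2005, §3.4 Prop. 3.36] -/
theorem hasHydroMap_pastHull_of_notMem (η : (discreteDomainGraph D.carrier δ).Walk a w)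
    (h0 : meshPoint δ a ∈ D.carrier) (hb : φ.HasBoundaryValueAtInfty (D.pt 1))
    (hnb : D.pt 1 ∉ range (η.toCurve (meshPoint δ))) : HasHydroMap (pastHull φ η) :=
  (isBoundedHull_pastHull_of_notMem η h0 hb hnb).hasHydroMap

/-- `2 t_η = hcap(K_η)` computed with the chosen hydrodynamic map. [cite: Lawler2005, §3.4 Def. 3.37] -/
theorem two_mul_capTime_eq_hcap_of_notMem (η : (discreteDomainGraph D.carrier δ).Walk a w)
    (h0 : meshPoint δ a ∈ D.carrier) (hb : φ.HasBoundaryValueAtInfty (D.pt 1))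
    (hnb : D.pt 1 ∉ range (η.toCurve (meshPoint δ))) :
    2 * capTime φ η =
      hcap (pastHull φ η) (hydroEquiv (pastHull φ η) (hasHydroMap_pastHull_of_notMem η h0 hb hnb)) := by
  rw [two_mul_capTime, hcapOf_of_hasHydroMap (hasHydroMap_pastHull_of_notMem η h0 hb hnb)]

/-- **`t_η > 0`** for a walk started inside `D` and avoiding `b` (the hull contains the base point,
Lawler (2005), (3.8)). [cite: Lawler2005, §3.4 (3.8)] -/
theorem capTime_pos_of_notMem (η : (discreteDomainGraph D.carrier δ).Walk a w)
    (h0 : meshPoint δ a ∈ D.carrier) (hb : φ.HasBoundaryValueAtInfty (D.pt 1))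
    (hnb : D.pt 1 ∉ range (η.toCurve (meshPoint δ))) : 0 < capTime φ η := by
  have hz₀ : 0 < (basePt φ δ a).im := φ.symm_mapsTo h0
  have hK := isBoundedHull_pastHull_of_notMem (φ := φ) η h0 hb hnb
  have hbdd : IsBounded (pastHull φ η ∩ upperHalfPlaneSet) := hK.1.subset inter_subset_left
  have hmem : basePt φ δ a ∈ pastHull φ η ∩ upperHalfPlaneSet :=
    ⟨inter_subset_hpFill _ ⟨subset_closure (Or.inl (self_mem_stemArc _)), hz₀⟩, hz₀⟩
  have hpos := (isHydrodynamicMap_hydroEquiv (hasHydroMap_pastHull_of_notMem (φ := φ) η h0 hb hnb)).hcap_pos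
    hbdd ⟨_, hmem⟩
  have h2 := two_mul_capTime_eq_hcap_of_notMem (φ := φ) η h0 hb hnb
  linarith

/-- **`(im z)² ≤ 4 t_η` on the generating set** of a walk started inside `D` and avoiding `b`.
[cite: KemppainenSmirnov2017, App. A Lemma A.13] -/
theorem im_sq_le_four_mul_capTime_of_notMem (η : (discreteDomainGraph D.carrier δ).Walk a w)
    (h0 : meshPoint δ a ∈ D.carrier) (hb : φ.HasBoundaryValueAtInfty (D.pt 1))
    (hnb : D.pt 1 ∉ range (η.toCurve (meshPoint δ))) {z : ℂ} (hz : z ∈ pastSet φ η) (hzi : 0 < z.im) :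
    z.im ^ 2 ≤ 4 * capTime φ η := by
  obtain ⟨hcl, hbd, hconn⟩ := pastSet_attached_of_notMem (φ := φ) η h0 hb hnb
  have h := im_sq_le_two_mul_hcap_hpFill hcl hbd hconn hz hzi
    (isHydrodynamicMap_hydroEquiv (hasHydroMap_pastHull_of_notMem (φ := φ) η h0 hb hnb))
  have h2 := two_mul_capTime_eq_hcap_of_notMem (φ := φ) η h0 hb hnb
  change z.im ^ 2 ≤ 2 * hcap (pastHull φ η) _ at h
  linarith

/-- **`(im φ⁻¹(δ v))² ≤ 4 t_η` at every vertex** of a walk started inside `D` and avoiding `b`.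
[cite: KemppainenSmirnov2017, App. A Lemma A.13] -/
theorem im_symm_sq_le_four_mul_capTime_of_notMem (η : (discreteDomainGraph D.carrier δ).Walk a w)
    (h0 : meshPoint δ a ∈ D.carrier) (hb : φ.HasBoundaryValueAtInfty (D.pt 1))
    (hnb : D.pt 1 ∉ range (η.toCurve (meshPoint δ))) {v : Site 2} (hv : v ∈ η.support) :
    (φ.symm (meshPoint δ v)).im ^ 2 ≤ 4 * capTime φ η := by
  have hvD : meshPoint δ v ∈ D.carrier := meshPoint_mem_of_mem_support η h0 hv
  have htr : φ.symm (meshPoint δ v) ∈ trace φ η :=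
    ⟨meshPoint δ v, ⟨SimpleGraph.Walk.mem_range_toCurve (meshPoint δ) η hv, hvD⟩, rfl⟩
  exact im_sq_le_four_mul_capTime_of_notMem η h0 hb hnb (subset_closure (Or.inr htr))
    (φ.symm_mapsTo hvD)

/-- **Capped pasts avoiding `b` stay away from interior points.** For `w ∈ ℍ` there is `ρ > 0`
(depending only on `φ` and `w`) such that every walk of `Ω_δ` started inside `D`, with polyline
avoiding `b = φ(∞)` and capacity time `t_η ≤ (Im w)²/16`, keeps all its vertices at distance `≥ ρ`
from `φ(w)`. [cite: KemppainenSmirnov2017, App. A Lemma A.13] -/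
theorem exists_radius_forall_le_dist_of_notMem (φ : ConformalEquiv upperHalfPlaneSet D.carrier)
    (hb : φ.HasBoundaryValueAtInfty (D.pt 1)) {w : ℂ} (hw : 0 < w.im) :
    ∃ ρ : ℝ, 0 < ρ ∧ ∀ {δ : ℝ} {a w' : Site 2} (η : (discreteDomainGraph D.carrier δ).Walk a w'),
      meshPoint δ a ∈ D.carrier → D.pt 1 ∉ range (η.toCurve (meshPoint δ)) →
      capTime φ η ≤ w.im ^ 2 / 16 → ∀ v ∈ η.support, ρ ≤ dist (meshPoint δ v) (φ w) := by
  have hwH : w ∈ upperHalfPlaneSet := hw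
  have hφw : φ w ∈ D.carrier := φ.mapsTo hwH
  have hcont : ContinuousAt φ.symm (φ w) :=
    (φ.symm.continuousOn (φ w) hφw).continuousAt (D.isOpen.mem_nhds hφw)
  have hball : ∀ᶠ p in 𝓝 (φ w), dist (φ.symm p) (φ.symm (φ w)) < w.im / 2 :=
    hcont (ball_mem_nhds _ (by positivity))
  obtain ⟨ρ, hρ, hρball⟩ := Metric.eventually_nhds_iff.1 hball
  refine ⟨ρ, hρ, fun {δ a w'} η h0 hnb hcap v hv ↦ ?_⟩
  by_contra hlt
  have hdist : dist (meshPoint δ v) (φ w) < ρ := lt_of_not_ge hlt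
  have h1 := hρball hdist
  rw [φ.symm_apply_apply hwH] at h1
  have him : w.im / 2 < (φ.symm (meshPoint δ v)).im := by
    have h2 : |(φ.symm (meshPoint δ v) - w).im| ≤ ‖φ.symm (meshPoint δ v) - w‖ := abs_im_le_norm _
    rw [dist_eq_norm] at h1
    have h3 : -(w.im / 2) < (φ.symm (meshPoint δ v) - w).im := by
      have := neg_abs_le (φ.symm (meshPoint δ v) - w).im
      linarith
    rw [sub_im] at h3
    linarith
  have hle := im_symm_sq_le_four_mul_capTime_of_notMem (φ := φ) η h0 hb hnb hv
  nlinarith [him, hle, hcap, hw]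

end LatticeSlit

end Literature.Probability.RandomPlanarGeometry

end
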